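import Literature.MathematicalPhysics.QuantumManyBody.PeriodicBoseGasFracEnergy
import Literature.MathematicalPhysics.QuantumManyBody.OneParticleMarginals
import Literature.MathematicalPhysics.QuantumManyBody.BoseGasMergeOccupation
import Literature.MathematicalPhysics.QuantumManyBody.LiebYngvasonBoxBound
import Literature.MathematicalPhysics.QuantumManyBody.DyadicCoherentFractionRefinement
import Literature.MathematicalPhysics.QuantumManyBody.NeumannMomentumCutoffs
import Literature.MathematicalPhysics.QuantumManyBody.BoseGasProductState

/-!
# `BecDepletionCounting` (stmt-AtomisticToContinuum-9034), helper file 2/3: the shell transfer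

Route `BECInfraredBound` of `AtomisticToContinuum/BoseEinsteinCondensation`, mode-counting glue piece 3/3,
line `translate-traced-parseval` of the crux chain. This file proves the second analytic input of the
counting step, the symmetry-free SHELL TRANSFER from the normalised constant mode `φ'_0` of the half-open
inner cube `S = ∏ [εL, L−εL)` to the normalised constant mode `φ₀` of the box `Λ = (0,L)³`:

  `(1−2ε)³ · ⟨φ'_0, γ_Ψ φ'_0⟩ ≤ 2 · ⟨φ₀, γ_Ψ φ₀⟩ + 12 ε (n+1)`   (`shellTransfer`)

for every trial state `Ψ` of `n+1` bosons. Fibrewise (`fibre_transfer`): with `a = ∫_S f`, `t = ∫_Λ f`,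
`b = ∫_{Λ∖S} f` one has `t = a + b`, the parallelogram bound `|a|² ≤ 2|t|² + 2|b|²`, Cauchy–Schwarz
`|b|² ≤ |Λ∖S| ∫ |f|²` and `|Λ∖S| ≤ 6εL³` (`volume_box_diff_innerIco_le`); the normalisations satisfy
`(1−2ε)³ c'² = c² = L⁻³`. Integrating over the spectators (`lintegral_fibre_transfer`) and `‖Ψ‖ = 1` give
the claim. The half-open inner cube is written as the literal set `{x | ∀ j, x j ∈ Set.Ico (ε * L) (L - ε * L)}`
throughout (no auxiliary definitions); `‖c z‖₊² = c²‖z‖₊²` is `BoseGas.ennorm_real_mul_sq` of the tree.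

References: LSSY2005 Ch. 11 (11.26)–(11.27); DysonLiebSimon1978 §1.
-/

noncomputable section

open MeasureTheory Complex WithLp
open scoped ENNReal NNReal ComplexConjugate BigOperators

namespace Summit.AtomisticToContinuum.BoseEinsteinCondensation.Theorems.BECInfraredBoundDepletionCounting

open Literature.MathematicalPhysics.QuantumManyBody.BoseGas

/-- Pairing with an indicator-cut mode = restricted pairing (set-integral form). -/
theorem integral_conj_indicator_mul' {s : Set Space} (hs : MeasurableSet s) (φ G : Space → ℂ) :
    ∫ x, conj (s.indicator φ x) * G x = ∫ x in s, conj (φ x) * G x := by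
  rw [← integral_indicator hs]
  refine integral_congr_ae (Filter.Eventually.of_forall fun x => ?_)
  by_cases hx : x ∈ s
  · simp [Set.indicator_of_mem hx]
  · simp [Set.indicator_of_notMem hx]

/-- The half-open inner cube is measurable (finite intersection of coordinate slabs). -/
theorem measurableSet_innerIco (L ε : ℝ) : MeasurableSet {x : Space | ∀ j, x j ∈ Set.Ico (ε * L) (L - ε * L)} := by
  have : {x : Space | ∀ j, x j ∈ Set.Ico (ε * L) (L - ε * L)} = ⋂ j : Fin 3, (fun x : Space => x j) ⁻¹' Set.Ico (ε * L) (L - ε * L) := by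
    ext x; simp
  rw [this]
  exact MeasurableSet.iInter fun j => measurableSet_Ico.preimage (by fun_prop)

/-- The half-open inner cube lies in the open box `(0,L)³` (for `L, ε > 0`). -/
theorem innerIco_subset_box {L ε : ℝ} (hL : 0 < L) (hε : 0 < ε) : {x : Space | ∀ j, x j ∈ Set.Ico (ε * L) (L - ε * L)} ⊆ box L := by
  intro x hx k
  have h1 := (hx k).1
  have h2 := (hx k).2
  have hεL : 0 < ε * L := mul_pos hε hL
  simp only [Set.mem_Ioo]
  exact ⟨by linarith, by linarith⟩

/-- The half-open inner cube is the preimage of the cell of side `(1-2ε)L` under `x ↦ x - a`,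
`a = εL·𝟙` (any `a` with all coordinates `εL`). -/
theorem innerIco_eq_preimage {L ε : ℝ} {a : Space} (ha : ∀ j, a j = ε * L) :
    {x : Space | ∀ j, x j ∈ Set.Ico (ε * L) (L - ε * L)} = (fun x : Space => x + (-a)) ⁻¹' cell ((1 - 2 * ε) * L) := by
  ext x
  simp only [cell, Set.mem_setOf_eq, Set.mem_Ico, Set.mem_preimage, PiLp.add_apply,
    PiLp.neg_apply, ha]
  refine forall_congr' fun j => ?_
  constructor <;> rintro ⟨h1, h2⟩ <;> constructor <;> linarith

/-- `|box L ∖ innerIco| ≤ 6 ε L³`. -/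
theorem volume_box_diff_innerIco_le {L ε : ℝ} (hL : 0 < L) (hε : 0 < ε) (hε4 : ε < 1 / 4) :
    volume (box L \ {x : Space | ∀ j, x j ∈ Set.Ico (ε * L) (L - ε * L)}) ≤ ENNReal.ofReal (6 * ε * L ^ 3) := by
  obtain ⟨a, ha⟩ : ∃ a : Space, ∀ j, a j = ε * L := ⟨toLp 2 fun _ => ε * L, fun _ => rfl⟩
  have hL' : 0 ≤ (1 - 2 * ε) * L := by nlinarith
  have hS : volume {x : Space | ∀ j, x j ∈ Set.Ico (ε * L) (L - ε * L)} = ENNReal.ofReal (((1 - 2 * ε) * L) ^ 3) := by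
    rw [innerIco_eq_preimage ha, measure_preimage_add_right, volume_cell, ENNReal.ofReal_pow hL']
  rw [measure_sdiff (innerIco_subset_box hL hε) (measurableSet_innerIco L ε).nullMeasurableSet
      (by rw [hS]; exact ENNReal.ofReal_ne_top), volume_box, hS, ← ENNReal.ofReal_pow hL.le]
  rw [tsub_le_iff_right, ← ENNReal.ofReal_add (by positivity) (by positivity)]
  refine ENNReal.ofReal_le_ofReal ?_
  have : 6 * ε * L ^ 3 + ((1 - 2 * ε) * L) ^ 3 - L ^ 3 = 4 * ε ^ 2 * (3 - 2 * ε) * L ^ 3 := by ring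
  have h32 : 0 < 3 - 2 * ε := by linarith
  nlinarith [mul_pos (mul_pos (mul_pos (by norm_num : (0:ℝ) < 4) (pow_pos hε 2)) h32) (pow_pos hL 3)]

/-- The box lies in the compact closed box (for integrability of continuous slices). -/
theorem box_subset_closedBox (L : ℝ) :
    box L ⊆ (toLp 2 '' Set.univ.pi fun _ : Fin 3 => Set.Icc (0 : ℝ) L : Set Space) := fun x hx =>
  ⟨ofLp x, fun k _ => ⟨(hx k).1.le, (hx k).2.le⟩, rfl⟩

/-- FIBRE TRANSFER: for a continuous one-body `f`,
`(1-2ε)³ |⟨φ'_0, f⟩|² ≤ 2 |⟨φ₀, f⟩|² + 12 ε ∫ |f|²` (parallelogram + Cauchy–Schwarz on the shell). -/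
theorem fibre_transfer {L ε : ℝ} (hL : 0 < L) (hε : 0 < ε) (hε4 : ε < 1 / 4) {f : Space → ℂ}
    (hf : Continuous f) :
    ENNReal.ofReal ((1 - 2 * ε) ^ 3) *
        (‖∫ x, conj ({x : Space | ∀ j, x j ∈ Set.Ico (ε * L) (L - ε * L)}.indicator (fun _ => ((Real.sqrt (((1 - 2 * ε) * L) ^ 3))⁻¹ : ℂ)) x) *
            f x‖₊ : ℝ≥0∞) ^ 2 ≤
      2 * (‖∫ x, conj ((box L).indicator (fun _ => ((Real.sqrt (L ^ 3))⁻¹ : ℂ)) x) * f x‖₊ : ℝ≥0∞) ^ 2 +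
        ENNReal.ofReal (12 * ε) * ∫⁻ x, (‖f x‖₊ : ℝ≥0∞) ^ 2 := by
  have hL' : 0 < (1 - 2 * ε) * L := mul_pos (by linarith) hL
  set c' : ℝ := (Real.sqrt (((1 - 2 * ε) * L) ^ 3))⁻¹ with hc'
  set c : ℝ := (Real.sqrt (L ^ 3))⁻¹ with hc
  have hc'0 : 0 ≤ c' := by positivity
  have hc0 : 0 ≤ c := by positivity
  have hS := measurableSet_innerIco L ε
  have hSB := innerIco_subset_box hL hε
  -- integrability of the continuous slice on the bounded box
  have hint_box : IntegrableOn f (box L) volume :=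
    (hf.continuousOn.integrableOn_compact (isCompact_closedBox L)).mono_set (box_subset_closedBox L)
  have hint_S : IntegrableOn f {x : Space | ∀ j, x j ∈ Set.Ico (ε * L) (L - ε * L)} volume := hint_box.mono_set hSB
  have hint_D : IntegrableOn f (box L \ {x : Space | ∀ j, x j ∈ Set.Ico (ε * L) (L - ε * L)}) volume := hint_box.mono_set Set.sdiff_subset
  -- the three integrals
  set a : ℂ := ∫ x in {x : Space | ∀ j, x j ∈ Set.Ico (ε * L) (L - ε * L)}, f x with ha
  set t : ℂ := ∫ x in box L, f x with ht
  set b : ℂ := ∫ x in box L \ {x : Space | ∀ j, x j ∈ Set.Ico (ε * L) (L - ε * L)}, f x with hb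
  have htab : t = a + b := by
    rw [ha, hb, ← setIntegral_union (Set.disjoint_sdiff_right) (measurableSet_box L |>.diff hS)
      hint_S hint_D, Set.union_sdiff_cancel hSB]
  have hIA : ∫ x, conj ({x : Space | ∀ j, x j ∈ Set.Ico (ε * L) (L - ε * L)}.indicator (fun _ => (c' : ℂ)) x) * f x = (c' : ℂ) * a := by
    rw [integral_conj_indicator_mul' hS, ha, ← integral_const_mul]
    simp [Complex.conj_ofReal]
  have hIB : ∫ x, conj ((box L).indicator (fun _ => (c : ℂ)) x) * f x = (c : ℂ) * t := by
    rw [integral_conj_indicator_mul' (measurableSet_box L), ht, ← integral_const_mul]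
    simp [Complex.conj_ofReal]
  -- the literal casts `(↑√…)⁻¹ : ℂ` are `↑c'`, `↑c`
  have hcast' : ((Real.sqrt (((1 - 2 * ε) * L) ^ 3))⁻¹ : ℂ) = ((c' : ℝ) : ℂ) := by
    rw [hc', Complex.ofReal_inv]
  have hcast : ((Real.sqrt (L ^ 3))⁻¹ : ℂ) = ((c : ℝ) : ℂ) := by
    rw [hc, Complex.ofReal_inv]
  simp_rw [hcast', hcast]
  rw [hIA, hIB, ennorm_real_mul_sq c' hc'0, ennorm_real_mul_sq c hc0]
  -- constants: (1-2ε)³ c'² = c²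
  have h12 : 0 < 1 - 2 * ε := by linarith
  have h12ne : (1 - 2 * ε) ≠ 0 := h12.ne'
  have hLne : L ≠ 0 := hL.ne'
  have hcc : (1 - 2 * ε) ^ 3 * c' ^ 2 = c ^ 2 := by
    rw [hc', hc, inv_pow, inv_pow, Real.sq_sqrt (by positivity), Real.sq_sqrt (by positivity)]
    field_simp
    try ring
  have hcL : c ^ 2 * L ^ 3 = 1 := by
    rw [hc, inv_pow, Real.sq_sqrt (by positivity)]
    field_simp
  rw [← mul_assoc, ← ENNReal.ofReal_mul (pow_nonneg h12.le 3), hcc]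
  -- Cauchy–Schwarz on the shell part
  have hbCS : (‖b‖₊ : ℝ≥0∞) ^ 2 ≤ ENNReal.ofReal (6 * ε * L ^ 3) * ∫⁻ x, (‖f x‖₊ : ℝ≥0∞) ^ 2 := by
    have h1 := nnnorm_integral_sq_le_mul_lintegral (volume.restrict (box L \ {x : Space | ∀ j, x j ∈ Set.Ico (ε * L) (L - ε * L)}))
      (f := f) hf.measurable.aemeasurable
    rw [Measure.restrict_apply_univ] at h1
    refine h1.trans ?_
    exact mul_le_mul' (volume_box_diff_innerIco_le hL hε hε4) (setLIntegral_le_lintegral _ _)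
  -- parallelogram in ENNReal
  have hpar : (‖a‖₊ : ℝ≥0∞) ^ 2 ≤ 2 * (‖t‖₊ : ℝ≥0∞) ^ 2 + 2 * (‖b‖₊ : ℝ≥0∞) ^ 2 := by
    have hreal : ‖t - b‖ ^ 2 ≤ 2 * ‖t‖ ^ 2 + 2 * ‖b‖ ^ 2 := by
      have hsq : ‖t - b‖ ^ 2 ≤ (‖t‖ + ‖b‖) ^ 2 := by
        rw [sq, sq]; exact mul_self_le_mul_self (norm_nonneg _) (norm_sub_le t b)
      nlinarith [sq_nonneg (‖t‖ - ‖b‖)]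
    have hab : a = t - b := by rw [htab]; ring
    rw [hab, coe_nnnorm_sq_eq_ofReal, coe_nnnorm_sq_eq_ofReal, coe_nnnorm_sq_eq_ofReal]
    calc ENNReal.ofReal (‖t - b‖ ^ 2) ≤ ENNReal.ofReal (2 * ‖t‖ ^ 2 + 2 * ‖b‖ ^ 2) :=
          ENNReal.ofReal_le_ofReal hreal
      _ = 2 * ENNReal.ofReal (‖t‖ ^ 2) + 2 * ENNReal.ofReal (‖b‖ ^ 2) := by
          rw [ENNReal.ofReal_add (by positivity) (by positivity), ENNReal.ofReal_mul (by norm_num),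
            ENNReal.ofReal_mul (by norm_num), ENNReal.ofReal_ofNat]
  calc ENNReal.ofReal (c ^ 2) * (‖a‖₊ : ℝ≥0∞) ^ 2
      ≤ ENNReal.ofReal (c ^ 2) * (2 * (‖t‖₊ : ℝ≥0∞) ^ 2 + 2 * (‖b‖₊ : ℝ≥0∞) ^ 2) :=
        mul_le_mul_right hpar _
    _ = 2 * (ENNReal.ofReal (c ^ 2) * (‖t‖₊ : ℝ≥0∞) ^ 2) +
          2 * ENNReal.ofReal (c ^ 2) * (‖b‖₊ : ℝ≥0∞) ^ 2 := by ring
    _ ≤ 2 * (ENNReal.ofReal (c ^ 2) * (‖t‖₊ : ℝ≥0∞) ^ 2) +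
          2 * ENNReal.ofReal (c ^ 2) * (ENNReal.ofReal (6 * ε * L ^ 3) * ∫⁻ x, (‖f x‖₊ : ℝ≥0∞) ^ 2) :=
        by gcongr
    _ = 2 * (ENNReal.ofReal (c ^ 2) * (‖t‖₊ : ℝ≥0∞) ^ 2) +
          ENNReal.ofReal (12 * ε) * ∫⁻ x, (‖f x‖₊ : ℝ≥0∞) ^ 2 := by
        have h12c : (2 : ℝ≥0∞) * ENNReal.ofReal (c ^ 2) * ENNReal.ofReal (6 * ε * L ^ 3) =
            ENNReal.ofReal (12 * ε) := by
          rw [show (2 : ℝ≥0∞) = ENNReal.ofReal 2 from (ENNReal.ofReal_ofNat 2).symm,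
            ← ENNReal.ofReal_mul (by norm_num), ← ENNReal.ofReal_mul (by positivity)]
          congr 1
          rw [show (2 : ℝ) * c ^ 2 * (6 * ε * L ^ 3) = 12 * ε * (c ^ 2 * L ^ 3) by ring, hcL, mul_one]
        congr 1
        rw [← mul_assoc, h12c]

/-- Abstract integration of a fibrewise transfer inequality. -/
theorem lintegral_fibre_transfer {n : ℕ} {F1 F2 G : Config n → ℝ≥0∞} (hG : Measurable G)
    {A B : ℝ≥0∞} (hA : A ≠ ⊤) (hfib : ∀ Y, A * F1 Y ≤ 2 * F2 Y + B * G Y) (m : ℝ≥0∞) :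
    A * (m * ∫⁻ Y, F1 Y) ≤ 2 * (m * ∫⁻ Y, F2 Y) + B * (m * ∫⁻ Y, G Y) := by
  calc A * (m * ∫⁻ Y, F1 Y) = m * ∫⁻ Y, A * F1 Y := by
        rw [lintegral_const_mul' A _ hA]; ring
    _ ≤ m * ∫⁻ Y, (2 * F2 Y + B * G Y) := by
        gcongr with Y
        exact hfib Y
    _ = m * (2 * ∫⁻ Y, F2 Y) + m * (B * ∫⁻ Y, G Y) := by
        rw [lintegral_add_right _ (hG.const_mul B), lintegral_const_mul' 2 _ (by simp),
          lintegral_const_mul B hG, mul_add]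
    _ = 2 * (m * ∫⁻ Y, F2 Y) + B * (m * ∫⁻ Y, G Y) := by ring

/-- SHELL TRANSFER (symmetry-free):
`(1-2ε)³ · occ(φ'_0)Ψ ≤ 2 · occ(φ₀)Ψ + 12 ε (n+1)` for every trial state, where `φ'_0` is the
normalised constant mode of the half-open inner cube and `φ₀` that of the box. -/
theorem shellTransfer {n : ℕ} {L ε : ℝ} (hL : 0 < L) (hε : 0 < ε) (hε4 : ε < 1 / 4)
    (Ψ : TrialState (n + 1) L) :
    ENNReal.ofReal ((1 - 2 * ε) ^ 3) *
        occupation (n + 1)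
          ({x : Space | ∀ j, x j ∈ Set.Ico (ε * L) (L - ε * L)}.indicator
            fun _ => ((Real.sqrt (((1 - 2 * ε) * L) ^ 3))⁻¹ : ℂ)) Ψ.ψ ≤
      2 * occupation (n + 1) ((box L).indicator fun _ => ((Real.sqrt (L ^ 3))⁻¹ : ℂ)) Ψ.ψ +
        ENNReal.ofReal (12 * ε) * ((n : ℝ≥0∞) + 1) := by
  have hΨc : Continuous Ψ.ψ := Ψ.contDiff.continuous
  have hslice : ∀ Y : Config n, Continuous fun x : Space => Ψ.ψ (Matrix.vecCons x Y) := fun Y =>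
    hΨc.comp (continuous_id.matrixVecCons continuous_const)
  have hG : Measurable fun Y : Config n => ∫⁻ x, (‖Ψ.ψ (Matrix.vecCons x Y)‖₊ : ℝ≥0∞) ^ 2 := by
    have hj : Measurable (Function.uncurry fun (Y : Config n) (x : Space) =>
        (‖Ψ.ψ (Matrix.vecCons x Y)‖₊ : ℝ≥0∞) ^ 2) := by
      show Measurable fun p : Config n × Space => (‖Ψ.ψ (Matrix.vecCons p.2 p.1)‖₊ : ℝ≥0∞) ^ 2
      exact (hΨc.measurable.comp (measurable_vecCons.comp measurable_swap)).nnnorm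
        |>.coe_nnreal_ennreal.pow_const _
    exact hj.lintegral_prod_right'
  have htot : ∫⁻ Y : Config n, ∫⁻ x, (‖Ψ.ψ (Matrix.vecCons x Y)‖₊ : ℝ≥0∞) ^ 2 = 1 := by
    have hF : Measurable fun X : Config (n + 1) => (‖Ψ.ψ X‖₊ : ℝ≥0∞) ^ 2 :=
      hΨc.measurable.nnnorm.coe_nnreal_ennreal.pow_const _
    have hAE : AEMeasurable (Function.uncurry fun (x : Space) (Y : Config n) =>
        (‖Ψ.ψ (Matrix.vecCons x Y)‖₊ : ℝ≥0∞) ^ 2) (volume.prod volume) :=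
      (hF.comp measurable_vecCons).aemeasurable
    rw [← lintegral_lintegral_swap hAE, lintegral_lintegral_vecCons hF, Ψ.norm_eq]
  simp only [occupation]
  refine (lintegral_fibre_transfer hG ENNReal.ofReal_ne_top
    (fun Y => fibre_transfer hL hε hε4 (hslice Y)) _).trans_eq ?_
  rw [htot, mul_one]

end Summit.AtomisticToContinuum.BoseEinsteinCondensation.Theorems.BECInfraredBoundDepletionCounting

end
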